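import Literature.Topology.FourManifolds.Gluing
import Literature.Topology.FourManifolds.GluingProofs
import Literature.Topology.FourManifolds.ClosedBall
import Literature.Topology.FourManifolds.ClosedBallProofs
import Literature.Topology.FourManifolds.CorkDecomposition
import Literature.Topology.FourManifolds.CerfGammaFourProofs
import HarnessLib

/-!
# Crux `ConvexBisection.PlanarAcyclicBisectionRigidity`, line Sketch — helper `helper_double_closedBall_sphere`

**The double of a `4`-ball along any boundary datum is `S⁴`.**  If `W ≅ 𝔻⁴` (by `e`) and `P` is a
double of `W` along a boundary datum `b` (`IsDouble b (𝓡 4) P`, `Gluing.lean`), then `P ≅ S⁴`.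
Pure transport over the relational gluing predicates of `Literature/Topology/FourManifolds/Gluing.lean`:

* `S⁴ = 𝔻⁴ ∪_{id} 𝔻⁴` is the tree's PROVED `isDouble_sphere_holds` (`ClosedBallProofs.lean`);
* transporting both pieces `𝔻⁴` to `W` along `e` (`IsBoundaryGluing.transfer` of
  `CorkDecomposition.lean`, twice, with `IsBoundaryGluing.symm'` in between) exhibits `S⁴` as
  `W ∪_{∂e⁻¹ ∘ ∂e} W`, where `∂e = b.restrictDiffeomorph (closedBallBoundaryData 3) e : ∂W ≅ 𝕊³`,
  i.e. (`IsClosedGluing.congr`) as the double `W ∪_{id} W` along the SAME boundary datum `b`;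
* two gluings of the same compact pieces along the same diffeomorphism are diffeomorphic: the
  tree's PROVED uniqueness of gluings `nonempty_diffeomorph_of_isBoundaryGluing_holds`
  (`GluingProofs.lean`; Hirsch, *Differential Topology* (1976), Ch. 8 §2, Thm. 2.1).
-/

noncomputable section

open scoped Manifold ContDiff Topology
open Set Function Literature.Topology.FourManifolds

-- the prescribed namespace `Summit.<S>.<P>.…` repeats `SmoothPoincare4` (S = P = SmoothPoincare4)
set_option linter.dupNamespace false

namespace Summit.SmoothPoincare4.SmoothPoincare4.Theorems.PlanarAcyclicBisectionRigidity.Sketch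

/-- **`S⁴` is a double of every `4`-ball along every boundary datum.**  If `e : W ≅ 𝔻⁴` and `b` is
a boundary datum of `W`, then `S⁴ = W ∪_{id} W` along `b` (stated along `⇑(Diffeomorph.refl …)`,
the shape consumed by `nonempty_diffeomorph_of_isBoundaryGluing_holds`): transport both discs of
`S⁴ = 𝔻⁴ ∪_{id} 𝔻⁴` (`isDouble_sphere_holds`) to `W` along `e` (`IsBoundaryGluing.transfer`,
`IsBoundaryGluing.symm'`) and cancel `∂e⁻¹ ∘ ∂e = id` (`IsClosedGluing.congr`). [folklore] -/
theorem isBoundaryGluing_refl_sphere_of_diffeomorph_closedBall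
    (W : Type) [TopologicalSpace W] [ChartedSpace (EuclideanHalfSpace 4) W] [IsManifold (𝓡∂ 4) ∞ W]
    (e : W ≃ₘ⟮𝓡∂ 4, 𝓡∂ 4⟯ Metric.closedBall (0 : EuclideanSpace ℝ (Fin 4)) 1)
    (b : BoundaryData (𝓡∂ 4) W (𝓡 3)) :
    IsBoundaryGluing b b (Diffeomorph.refl (𝓡 3) b.carrier ∞) (𝓡 4)
      (Metric.sphere (0 : EuclideanSpace ℝ (Fin 5)) 1) := by
  -- `S⁴ = 𝔻⁴ ∪_{id} 𝔻⁴`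
  have h0 : IsBoundaryGluing (closedBallBoundaryData 3) (closedBallBoundaryData 3) id (𝓡 4)
      (Metric.sphere (0 : EuclideanSpace ℝ (Fin 5)) 1) :=
    isDouble_sphere_holds (n := 3)
  -- `S⁴ = W ∪_{∂e} 𝔻⁴`
  have h1 : IsBoundaryGluing b (closedBallBoundaryData 3)
      (b.restrictDiffeomorph (closedBallBoundaryData 3) e) (𝓡 4)
      (Metric.sphere (0 : EuclideanSpace ℝ (Fin 5)) 1) :=
    h0.transfer e
  -- `S⁴ = 𝔻⁴ ∪_{∂e⁻¹} W`
  have h2 : IsBoundaryGluing (closedBallBoundaryData 3) b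
      (b.restrictDiffeomorph (closedBallBoundaryData 3) e).symm (𝓡 4)
      (Metric.sphere (0 : EuclideanSpace ℝ (Fin 5)) 1) :=
    h1.symm'
  -- `S⁴ = W ∪_{∂e⁻¹ ∘ ∂e} W`
  have h3 : IsBoundaryGluing b b
      ((b.restrictDiffeomorph (closedBallBoundaryData 3) e).symm ∘
        b.restrictDiffeomorph (closedBallBoundaryData 3) e) (𝓡 4)
      (Metric.sphere (0 : EuclideanSpace ℝ (Fin 5)) 1) :=
    h2.transfer e
  -- `∂e⁻¹ ∘ ∂e = id`
  refine IsClosedGluing.congr h3 fun x y => ?_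
  simp only [comp_apply, Diffeomorph.symm_apply_apply, Diffeomorph.coe_refl, id_eq]

/-- **Helper (wave c2-1) — the double of a `4`-ball is `S⁴`.**  If `W ≅ D⁴` and `P` is a double of
`W` along any boundary datum `b`, then `P ≅ S⁴`: `S⁴` is itself the double `W ∪_{id} W` along `b`
(`isBoundaryGluing_refl_sphere_of_diffeomorph_closedBall`: transport of the tree's
`isDouble_sphere_holds`, `S⁴ = 𝔻⁴ ∪_{id} 𝔻⁴`, along `e` and along the induced diffeomorphism of
boundary data), and two gluings of the same compact pieces along the same diffeomorphism are
diffeomorphic by the PROVED gluing uniqueness `nonempty_diffeomorph_of_isBoundaryGluing_holds`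
(Hirsch, *Differential Topology* (1976), Ch. 8 §2, Thm. 2.1). [folklore] -/
theorem helper_double_closedBall_sphere
    (W : Type) [TopologicalSpace W] [T2Space W] [SecondCountableTopology W]
    [ChartedSpace (EuclideanHalfSpace 4) W] [IsManifold (𝓡∂ 4) ∞ W] [CompactSpace W]
    (e : W ≃ₘ⟮𝓡∂ 4, 𝓡∂ 4⟯ Metric.closedBall (0 : EuclideanSpace ℝ (Fin 4)) 1)
    (b : BoundaryData (𝓡∂ 4) W (𝓡 3))
    (P : Type) [TopologicalSpace P] [T2Space P] [SecondCountableTopology P]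
    [ChartedSpace (EuclideanSpace ℝ (Fin 4)) P] [IsManifold (𝓡 4) ∞ P] (hD : IsDouble b (𝓡 4) P) :
    Nonempty (P ≃ₘ⟮𝓡 4, 𝓡 4⟯ Metric.sphere (0 : EuclideanSpace ℝ (Fin 5)) 1) := by
  -- `P = W ∪_{id} W`, along `⇑(Diffeomorph.refl …) = id`
  have hP : IsBoundaryGluing b b (Diffeomorph.refl (𝓡 3) b.carrier ∞) (𝓡 4) P := by
    rw [Diffeomorph.coe_refl]
    exact hD
  exact nonempty_diffeomorph_of_isBoundaryGluing_holds hP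
    (isBoundaryGluing_refl_sphere_of_diffeomorph_closedBall W e b)

end Summit.SmoothPoincare4.SmoothPoincare4.Theorems.PlanarAcyclicBisectionRigidity.Sketch

end
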